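import Literature.MathematicalPhysics.QuantumLattice.HeisenbergOrderMerminWagnerProofs
import Literature.MathematicalPhysics.QuantumLattice.HeisenbergOrderMerminWagnerMagnetisationProofs
import Literature.MathematicalPhysics.QuantumLattice.HeisenbergOrderEvenTorusLROProofs
import HarnessLib

/-!
# Mermin–Wagner for the nearest-neighbour Heisenberg model: discharge of `mermin_wagner` and
# `mermin_wagner_staggered`

Topic `MathematicalPhysics/QuantumLattice`; sibling PROOF file of
`Literature/MathematicalPhysics/QuantumLattice/HeisenbergOrder.lean`. It DISCHARGES the two named
facts of that file which concern the nearest-neighbour Heisenberg model itself (hubbard.S12):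

* `mermin_wagner_holds : mermin_wagner` — for `d ∈ {1, 2}`, every spin `S = n/2`, every coupling
  `J` and every `β > 0`, the Gibbs states of `H_L = J Σ_{⟨x,y⟩} 𝐒_x · 𝐒_y` on the tori `(ℤ/Lℤ)^d`
  have no long-range order of `⟨𝐒_x · 𝐒_y⟩_{β,L}` (`¬ HasTorusLRO (spinSpinCorrTorus β · n J)`);
* `mermin_wagner_staggered_holds : mermin_wagner_staggered` — nor staggered (Néel) long-range
  order along the even tori (`¬ HasStaggeredEvenTorusLRO`), the antiferromagnetic half of
  Mermin–Wagner's title.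

Both follow from ONE uniform power-law bound,
`exists_abs_spinSpinCorrTorus_le_rpow : |⟨𝐒_x · 𝐒_y⟩_{β,L}| ≤ C' (dist(x,y) + 1)^{-f}` (`f > 0`,
`C'` independent of `L, x, y`), by the summation lemmas `not_hasTorusLRO_of_abs_le_rpow` (tree)
and `not_hasStaggeredEvenTorusLRO_of_abs_le_rpow` (this file: `|ε_x ε_y G| = |G|`).

## The printed proof followed

Koma–Tasaki, PRL **68** (1992) 3248, prove power-law decay of correlations in `d ≤ 2` at `T > 0`
by the McBryan–Spencer complex rotation (imaginary gauge `W_ψ = exp[-Σ_u ψ_u Ŝᶻ_u]`-type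
weights), eqs. (5)–(13); their note [11] records that the bound (4) holds "for a large class of
quantum spin systems with short range interaction which is invariant under the global rotation
about the `z`-axis", and the remark after the Theorem that such bounds "rigorously rule out ... the
corresponding magnetic ordering". The tree already formalises this route for an abstract
finite-range `LatticeInteraction` (`HeisenbergOrderMerminWagner{Gauge,Torus,}Proofs`,
discharging `mermin_wagner_general`). The named facts `mermin_wagner` / `mermin_wagner_staggered`
speak about the concrete graph Hamiltonian `heisenbergHamiltonian n (torusGraph d L) J`
(`heisenbergTorus`), which is not literally a `torusHamiltonian Φ L`; instead of building that
dictionary we redo the (short) model-dependent step of the printed proof for the Heisenberg bond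
directly — this is the genuinely shorter road:

* **eq. (9)/(11) for one bond, in closed form** (`hermitianPart_gauge_spinDot_sub`): with
  `δ = ψ_x - ψ_y`, `½(W (𝐒_x·𝐒_y) W⁻¹ + h.c.) - 𝐒_x·𝐒_y = (cosh δ - 1) (Bˣ_{xy} + Bʸ_{xy})`
  (`Bᵅ_{xy} = ½(Ŝᵅ_xŜᵅ_y + Ŝᵅ_yŜᵅ_x)`; the `z`-bond is gauge invariant, the planar part is
  `¼(Ŝ⁺_xŜ⁻_y + Ŝ⁻_yŜ⁺_x) + ¼(Ŝ⁻_xŜ⁺_y + Ŝ⁺_yŜ⁻_x)` with gauge eigenvalues `e^{±δ}` and the two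
  halves are exchanged by the adjoint), whence `‖·‖ ≤ ‖Ŝ⁺‖² (cosh δ - 1)`;
* **eq. (11) for the Hamiltonian on any finite graph** (`norm_hermitianPart_gauge_heisenberg_sub_le`):
  `‖½(W H W⁻¹ + h.c.) - H‖ ≤ |J| ‖Ŝ⁺‖² Σ_u Σ_v [u ∼ v] (cosh (ψ_u - ψ_v) - 1)`;
* **eqs. (6), (10)–(12) on the torus** (`norm_gibbsState_heisenbergTorus_le`): for a gauge
  eigen-operator `W A W⁻¹ = a A`,
  `|⟨A⟩_{β,L}| ≤ |a| ‖A‖ exp [β |J| ‖Ŝ⁺‖² Σ_u Σ_v [dist ≤ 1] (cosh (ψ_u - ψ_v) - 1)]`, from the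
  model-independent trace inequality `koma_tasaki_trace_bound` of the tree;
* **eqs. (12)–(13), P1–P2 and the `SU(2)` reduction** (`exists_abs_spinSpinCorrTorus_le_rpow`):
  verbatim the assembly of `exists_abs_spinSpinCorrTorusOf_le_rpow` (McBryan–Spencer profile
  `le_rpow_of_forall_testFunction_range` with range `ρ = 1` and charge multiplier `m = 1`; the four
  raising/lowering correlations; `⟨ŜᶻŜᶻ⟩ = ⟨ŜˣŜˣ⟩` by `gibbsState_siteSpin_two_mul_eq` and
  `commute_heisenbergHamiltonian_totalSpin`).

Theorems only: no definition, no named fact, no statement of the tree is introduced or changed.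

## Sources

* N. D. Mermin, H. Wagner, PRL **17** (1966) 1133 ("Absence of ferromagnetism or
  antiferromagnetism in one- or two-dimensional isotropic Heisenberg models").
* T. Koma, H. Tasaki, PRL **68** (1992) 3248 = arXiv:cond-mat/9709068 (held, read: p. 3 remark
  after the Theorem; note [11], p. 5), eqs. (5)–(13).
* K. R. Ito, J. Stat. Phys. **29** (1982) 747; O. A. McBryan, T. Spencer, CMP **53** (1977) 299.
* S. Friedli, Y. Velenik, *Statistical Mechanics of Lattice Systems* (2017) §3.7.2 (long-range
  order versus decay).
-/

noncomputable section

open Matrix Complex Finset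
open scoped Matrix.Norms.L2Operator ComplexOrder

namespace Literature.MathematicalPhysics.QuantumLattice.MerminWagner

open Literature.MathematicalPhysics.QuantumLattice

variable {Λ : Type*} [Fintype Λ] [DecidableEq Λ] {n : ℕ}

/-! ### The Heisenberg bond under the gauge (Koma–Tasaki eqs. (7)–(9) in closed form) -/

section Bond

/-- The planar part of the symmetrised exchange in terms of raising and lowering operators:
`Bˣ_{xy} + Bʸ_{xy} = ¼ (Ŝ⁺_xŜ⁻_y + Ŝ⁻_xŜ⁺_y + Ŝ⁺_yŜ⁻_x + Ŝ⁻_yŜ⁺_x)`.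
Tasaki (2020) §2.1, eq. (2.1.6) and §2.4. [cite: Tasaki2020, §2.1 eq. (2.1.6), §2.4 eq. (2.4.1)] -/
theorem spinBond_zero_add_one_eq (x y : Λ) :
    (spinBond n 0 x y + spinBond n 1 x y : Op Λ (n + 1)) =
      (1 / 4 : ℂ) • (onSite x (spinRaise n) * onSite y (spinLower n) +
        onSite x (spinLower n) * onSite y (spinRaise n) +
        onSite y (spinRaise n) * onSite x (spinLower n) +
        onSite y (spinLower n) * onSite x (spinRaise n)) := by
  have hc : (1 / (2 * I) : ℂ) * (1 / (2 * I)) = -(1 / 4 : ℂ) := by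
    rw [div_mul_div_comm, one_mul, show (2 * I * (2 * I) : ℂ) = 4 * (I * I) by ring, I_mul_I]
    norm_num
  simp only [spinBond, siteSpin_zero_eq, siteSpin_one_eq, smul_mul_smul_comm, hc]
  simp only [mul_add, add_mul, mul_sub, sub_mul, smul_add, smul_sub, neg_smul, smul_neg]
  module

/-- The gauge fixes `Ŝᶻ_x`: `W_ψ Ŝᶻ_x W_ψ⁻¹ = Ŝᶻ_x` (all weights are functions of the `Ŝᶻ_u`).
Koma–Tasaki, PRL 68 (1992) 3248, eq. (8). [cite: KomaTasakiPRL1992, eq. (8)] -/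
theorem gauge_conj_siteSpin_two (ψ : Λ → ℝ) (x : Λ) :
    ((Matrix.diagonal fun σ : TensorIndex _ (n + 1) =>
      ((Real.exp (-(∑ u, (ψ) u * ((σ u : ℕ) : ℝ))) : ℝ) : ℂ)) : Op Λ (n + 1)) * siteSpin n x 2 *
      (Matrix.diagonal fun σ : TensorIndex _ (n + 1) =>
      ((Real.exp (-(∑ u, (-ψ) u * ((σ u : ℕ) : ℝ))) : ℝ) : ℂ)) = (1 : ℂ) • siteSpin n x 2 := by
  rw [one_smul, siteSpin, spinVec_two, gauge_conj_onSite]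
  congr 1
  rw [SpinOperators.spinZ, diagonal_mul_diagonal, diagonal_mul_diagonal]
  congr 1
  funext k
  rw [mul_right_comm, ← Complex.ofReal_mul, ← Real.exp_add, neg_add_cancel, Real.exp_zero,
    Complex.ofReal_one, one_mul]

/-- The `z`-bond `Bᶻ_{xy} = ½(Ŝᶻ_xŜᶻ_y + Ŝᶻ_yŜᶻ_x)` is gauge invariant.
Koma–Tasaki, PRL 68 (1992) 3248, eq. (8). [cite: KomaTasakiPRL1992, eq. (8)] -/
theorem gauge_conj_spinBond_two (ψ : Λ → ℝ) (x y : Λ) :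
    ((Matrix.diagonal fun σ : TensorIndex _ (n + 1) =>
      ((Real.exp (-(∑ u, (ψ) u * ((σ u : ℕ) : ℝ))) : ℝ) : ℂ)) : Op Λ (n + 1)) * spinBond n 2 x y *
      (Matrix.diagonal fun σ : TensorIndex _ (n + 1) =>
      ((Real.exp (-(∑ u, (-ψ) u * ((σ u : ℕ) : ℝ))) : ℝ) : ℂ)) = spinBond n 2 x y := by
  have hxy := gauge_conj_mul ψ (gauge_conj_siteSpin_two (n := n) ψ x)
    (gauge_conj_siteSpin_two (n := n) ψ y)
  have hyx := gauge_conj_mul ψ (gauge_conj_siteSpin_two (n := n) ψ y)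
    (gauge_conj_siteSpin_two (n := n) ψ x)
  rw [one_mul, one_smul] at hxy hyx
  rw [spinBond, Matrix.mul_smul, Matrix.smul_mul, Matrix.mul_add, Matrix.add_mul, hxy, hyx]

/-- **Koma–Tasaki's perturbation for one Heisenberg bond, in closed form**: with `δ = ψ_x - ψ_y`,
`½ (W (𝐒_x · 𝐒_y) W⁻¹ + (W (𝐒_x · 𝐒_y) W⁻¹)ᴴ) - 𝐒_x · 𝐒_y = (cosh δ - 1) (Bˣ_{xy} + Bʸ_{xy})`
(the raising/lowering products are gauge eigen-operators with eigenvalues `e^{±δ}`, eq. (8), and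
the adjoint exchanges the `e^{δ}` and `e^{-δ}` halves). Koma–Tasaki, PRL 68 (1992) 3248,
eqs. (7)–(9). [cite: KomaTasakiPRL1992, eqs. (7)–(9)] -/
theorem hermitianPart_gauge_spinDot_sub (ψ : Λ → ℝ) (x y : Λ) :
    (2 : ℂ)⁻¹ • (((Matrix.diagonal fun σ : TensorIndex _ (n + 1) =>
      ((Real.exp (-(∑ u, (ψ) u * ((σ u : ℕ) : ℝ))) : ℝ) : ℂ)) : Op Λ (n + 1)) * spinDot n x y *
      (Matrix.diagonal fun σ : TensorIndex _ (n + 1) =>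
      ((Real.exp (-(∑ u, (-ψ) u * ((σ u : ℕ) : ℝ))) : ℝ) : ℂ)) +
      (((Matrix.diagonal fun σ : TensorIndex _ (n + 1) =>
      ((Real.exp (-(∑ u, (ψ) u * ((σ u : ℕ) : ℝ))) : ℝ) : ℂ)) : Op Λ (n + 1)) * spinDot n x y *
      (Matrix.diagonal fun σ : TensorIndex _ (n + 1) =>
      ((Real.exp (-(∑ u, (-ψ) u * ((σ u : ℕ) : ℝ))) : ℝ) : ℂ)))ᴴ) - spinDot n x y =
      ((Real.cosh (ψ x - ψ y) - 1 : ℝ) : ℂ) • (spinBond n 0 x y + spinBond n 1 x y) := by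
  set W : Op Λ (n + 1) := (Matrix.diagonal fun σ : TensorIndex _ (n + 1) =>
      ((Real.exp (-(∑ u, (ψ) u * ((σ u : ℕ) : ℝ))) : ℝ) : ℂ)) with hW
  set W' : Op Λ (n + 1) := (Matrix.diagonal fun σ : TensorIndex _ (n + 1) =>
      ((Real.exp (-(∑ u, (-ψ) u * ((σ u : ℕ) : ℝ))) : ℝ) : ℂ)) with hW'
  -- the four raising/lowering products and their gauge eigenvalues
  set Px : Op Λ (n + 1) := onSite x (spinRaise n) with hPx
  set Mx : Op Λ (n + 1) := onSite x (spinLower n) with hMx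
  set Py : Op Λ (n + 1) := onSite y (spinRaise n) with hPy
  set My : Op Λ (n + 1) := onSite y (spinLower n) with hMy
  have h1 : W * (Px * My) * W' = ((Real.exp (ψ x - ψ y) : ℝ) : ℂ) • (Px * My) := by
    rw [hW, hW', hPx, hMy, gauge_conj_mul ψ (gauge_conj_spinRaise ψ x) (gauge_conj_spinLower ψ y),
      ← Complex.ofReal_mul, ← Real.exp_add, ← sub_eq_add_neg]
  have h2 : W * (Mx * Py) * W' = ((Real.exp (-(ψ x - ψ y)) : ℝ) : ℂ) • (Mx * Py) := by
    rw [hW, hW', hMx, hPy, gauge_conj_mul ψ (gauge_conj_spinLower ψ x) (gauge_conj_spinRaise ψ y),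
      ← Complex.ofReal_mul, ← Real.exp_add, show -ψ x + ψ y = -(ψ x - ψ y) by ring]
  have h3 : W * (Py * Mx) * W' = ((Real.exp (-(ψ x - ψ y)) : ℝ) : ℂ) • (Py * Mx) := by
    rw [hW, hW', hPy, hMx, gauge_conj_mul ψ (gauge_conj_spinRaise ψ y) (gauge_conj_spinLower ψ x),
      ← Complex.ofReal_mul, ← Real.exp_add, show ψ y + -ψ x = -(ψ x - ψ y) by ring]
  have h4 : W * (My * Px) * W' = ((Real.exp (ψ x - ψ y) : ℝ) : ℂ) • (My * Px) := by
    rw [hW, hW', hMy, hPx, gauge_conj_mul ψ (gauge_conj_spinLower ψ y) (gauge_conj_spinRaise ψ x),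
      ← Complex.ofReal_mul, ← Real.exp_add, show -ψ y + ψ x = ψ x - ψ y by ring]
  have hZ : W * spinBond n 2 x y * W' = spinBond n 2 x y := gauge_conj_spinBond_two ψ x y
  -- adjoints
  have hPc : ∀ z : Λ, (onSite z (spinRaise n) : Op Λ (n + 1))ᴴ = onSite z (spinLower n) := fun z => by
    rw [← onSite_conjTranspose, ← spinLower_eq_conjTranspose]
  have hMc : ∀ z : Λ, (onSite z (spinLower n) : Op Λ (n + 1))ᴴ = onSite z (spinRaise n) := fun z => by
    rw [← onSite_conjTranspose, spinLower_eq_conjTranspose, conjTranspose_conjTranspose]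
  have h1c : (Px * My)ᴴ = Py * Mx := by rw [conjTranspose_mul, hMc, hPc]
  have h2c : (Mx * Py)ᴴ = My * Px := by rw [conjTranspose_mul, hPc, hMc]
  have h3c : (Py * Mx)ᴴ = Px * My := by rw [conjTranspose_mul, hMc, hPc]
  have h4c : (My * Px)ᴴ = Mx * Py := by rw [conjTranspose_mul, hPc, hMc]
  have hZc : (spinBond n 2 x y : Op Λ (n + 1))ᴴ = spinBond n 2 x y := (spinBond_isHermitian n 2 x y).eq
  -- the exchange operator split into its planar and axial parts
  have hdot : (spinDot n x y : Op Λ (n + 1)) =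
      (1 / 4 : ℂ) • (Px * My + Mx * Py + Py * Mx + My * Px) + spinBond n 2 x y := by
    rw [spinDot, Fin.sum_univ_three, spinBond_zero_add_one_eq]
  have hconj : W * spinDot n x y * W' =
      (1 / 4 : ℂ) • (((Real.exp (ψ x - ψ y) : ℝ) : ℂ) • (Px * My) +
        ((Real.exp (-(ψ x - ψ y)) : ℝ) : ℂ) • (Mx * Py) +
        ((Real.exp (-(ψ x - ψ y)) : ℝ) : ℂ) • (Py * Mx) +
        ((Real.exp (ψ x - ψ y) : ℝ) : ℂ) • (My * Px)) + spinBond n 2 x y := by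
    rw [hdot, Matrix.mul_add, Matrix.add_mul, hZ, Matrix.mul_smul, Matrix.smul_mul,
      Matrix.mul_add, Matrix.mul_add, Matrix.mul_add, Matrix.add_mul, Matrix.add_mul,
      Matrix.add_mul, h1, h2, h3, h4]
  have hstar : ∀ r : ℝ, star ((r : ℝ) : ℂ) = (r : ℂ) := fun r => Complex.conj_ofReal r
  have hconjT : (W * spinDot n x y * W')ᴴ =
      (1 / 4 : ℂ) • (((Real.exp (ψ x - ψ y) : ℝ) : ℂ) • (Py * Mx) +
        ((Real.exp (-(ψ x - ψ y)) : ℝ) : ℂ) • (My * Px) +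
        ((Real.exp (-(ψ x - ψ y)) : ℝ) : ℂ) • (Px * My) +
        ((Real.exp (ψ x - ψ y) : ℝ) : ℂ) • (Mx * Py)) + spinBond n 2 x y := by
    rw [hconj, conjTranspose_add, conjTranspose_smul, conjTranspose_add, conjTranspose_add,
      conjTranspose_add, conjTranspose_smul, conjTranspose_smul, conjTranspose_smul,
      conjTranspose_smul, h1c, h2c, h3c, h4c, hZc, hstar, hstar]
    have h4s : star (1 / 4 : ℂ) = 1 / 4 := by
      rw [show (1 / 4 : ℂ) = ((1 / 4 : ℝ) : ℂ) by push_cast; ring, hstar]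
    rw [h4s]
  have hcosh : ((Real.cosh (ψ x - ψ y) - 1 : ℝ) : ℂ) =
      (2 : ℂ)⁻¹ * (((Real.exp (ψ x - ψ y) : ℝ) : ℂ) + ((Real.exp (-(ψ x - ψ y)) : ℝ) : ℂ)) - 1 := by
    rw [Real.cosh_eq]
    push_cast
    ring
  rw [hconjT, hconj, spinBond_zero_add_one_eq, ← hPx, ← hMx, ← hPy, ← hMy, hdot, hcosh]
  module

/-- `‖Bˣ_{xy} + Bʸ_{xy}‖ ≤ ‖Ŝ⁺‖²` (four products of norm `≤ ‖Ŝ⁺‖ ‖Ŝ⁻‖ = ‖Ŝ⁺‖²`, weight `¼` each;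
`‖𝟙 ⊗ a ⊗ 𝟙‖ = ‖a‖`). Tasaki (2020) §2.1–2.2. [cite: Tasaki2020, §2.1 eq. (2.1.6), §2.2 eq. (2.2.5)] -/
theorem norm_spinBond_zero_add_one_le (x y : Λ) :
    ‖(spinBond n 0 x y + spinBond n 1 x y : Op Λ (n + 1))‖ ≤ ‖spinRaise n‖ * ‖spinRaise n‖ := by
  set s₀ : ℝ := ‖spinRaise n‖ with hs₀
  have hnP : ∀ z : Λ, ‖(onSite z (spinRaise n) : Op Λ (n + 1))‖ = s₀ := fun z => norm_onSite z _
  have hnM : ∀ z : Λ, ‖(onSite z (spinLower n) : Op Λ (n + 1))‖ = s₀ := by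
    intro z
    rw [norm_onSite, spinLower_eq_conjTranspose, l2_opNorm_conjTranspose]
  have hnorm : ∀ (A A' : Op Λ (n + 1)), ‖A‖ = s₀ → ‖A'‖ = s₀ → ‖A * A'‖ ≤ s₀ * s₀ := by
    intro A A' hA hA'
    calc ‖A * A'‖ ≤ ‖A‖ * ‖A'‖ := l2_opNorm_mul _ _
      _ = s₀ * s₀ := by rw [hA, hA']
  rw [spinBond_zero_add_one_eq, norm_smul]
  have hq : ‖(1 / 4 : ℂ)‖ = 1 / 4 := by norm_num
  rw [hq]
  have hsum : ‖(onSite x (spinRaise n) * onSite y (spinLower n) +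
        onSite x (spinLower n) * onSite y (spinRaise n) +
        onSite y (spinRaise n) * onSite x (spinLower n) +
        onSite y (spinLower n) * onSite x (spinRaise n) : Op Λ (n + 1))‖ ≤ 4 * (s₀ * s₀) := by
    refine (norm_add_le _ _).trans ?_
    refine (add_le_add (norm_add_le _ _) le_rfl).trans ?_
    refine (add_le_add (add_le_add (norm_add_le _ _) le_rfl) le_rfl).trans ?_
    linarith [hnorm _ _ (hnP x) (hnM y), hnorm _ _ (hnM x) (hnP y), hnorm _ _ (hnP y) (hnM x),
      hnorm _ _ (hnM y) (hnP x)]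
  linarith

/-- **Norm of the one-bond perturbation**: `‖½(W (𝐒_x·𝐒_y) W⁻¹ + h.c.) - 𝐒_x·𝐒_y‖ ≤
‖Ŝ⁺‖² (cosh (ψ_x - ψ_y) - 1)`. Koma–Tasaki, PRL 68 (1992) 3248, eq. (11) (one term).
[cite: KomaTasakiPRL1992, eq. (11)] -/
theorem norm_hermitianPart_gauge_spinDot_sub_le (ψ : Λ → ℝ) (x y : Λ) :
    ‖(2 : ℂ)⁻¹ • (((Matrix.diagonal fun σ : TensorIndex _ (n + 1) =>
      ((Real.exp (-(∑ u, (ψ) u * ((σ u : ℕ) : ℝ))) : ℝ) : ℂ)) : Op Λ (n + 1)) * spinDot n x y *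
      (Matrix.diagonal fun σ : TensorIndex _ (n + 1) =>
      ((Real.exp (-(∑ u, (-ψ) u * ((σ u : ℕ) : ℝ))) : ℝ) : ℂ)) +
      (((Matrix.diagonal fun σ : TensorIndex _ (n + 1) =>
      ((Real.exp (-(∑ u, (ψ) u * ((σ u : ℕ) : ℝ))) : ℝ) : ℂ)) : Op Λ (n + 1)) * spinDot n x y *
      (Matrix.diagonal fun σ : TensorIndex _ (n + 1) =>
      ((Real.exp (-(∑ u, (-ψ) u * ((σ u : ℕ) : ℝ))) : ℝ) : ℂ)))ᴴ) - spinDot n x y‖ ≤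
      ‖spinRaise n‖ * ‖spinRaise n‖ * (Real.cosh (ψ x - ψ y) - 1) := by
  rw [hermitianPart_gauge_spinDot_sub, norm_smul, Complex.norm_real, Real.norm_eq_abs,
    abs_of_nonneg (by linarith [Real.one_le_cosh (ψ x - ψ y)]), mul_comm]
  exact mul_le_mul_of_nonneg_right (norm_spinBond_zero_add_one_le x y)
    (by linarith [Real.one_le_cosh (ψ x - ψ y)])

end Bond

/-! ### The Heisenberg Hamiltonian of a finite graph under the gauge (Koma–Tasaki eq. (11)) -/

section Graph

variable (G : SimpleGraph Λ) [DecidableRel G.Adj]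

/-- **Koma–Tasaki's eq. (11) for the Heisenberg model on a finite graph**: for every real `ψ`,
`‖½(W H W⁻¹ + (W H W⁻¹)ᴴ) - H‖ ≤ |J| ‖Ŝ⁺‖² Σ_u Σ_v [u ∼ v] (cosh (ψ_u - ψ_v) - 1)` for
`H = J Σ_{⟨x,y⟩} 𝐒_x · 𝐒_y` (one bond at a time, `norm_hermitianPart_gauge_spinDot_sub_le`; each
edge is one of its two ordered pairs). Koma–Tasaki, PRL 68 (1992) 3248, eq. (11) and note [11].
[cite: KomaTasakiPRL1992, eq. (11) and note [11]] -/
theorem norm_hermitianPart_gauge_heisenberg_sub_le (J : ℝ) (ψ : Λ → ℝ) :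
    ‖(2 : ℂ)⁻¹ • (((Matrix.diagonal fun σ : TensorIndex _ (n + 1) =>
      ((Real.exp (-(∑ u, (ψ) u * ((σ u : ℕ) : ℝ))) : ℝ) : ℂ)) : Op Λ (n + 1)) *
      heisenbergHamiltonian n G J *
      (Matrix.diagonal fun σ : TensorIndex _ (n + 1) =>
      ((Real.exp (-(∑ u, (-ψ) u * ((σ u : ℕ) : ℝ))) : ℝ) : ℂ)) +
      (((Matrix.diagonal fun σ : TensorIndex _ (n + 1) =>
      ((Real.exp (-(∑ u, (ψ) u * ((σ u : ℕ) : ℝ))) : ℝ) : ℂ)) : Op Λ (n + 1)) *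
      heisenbergHamiltonian n G J *
      (Matrix.diagonal fun σ : TensorIndex _ (n + 1) =>
      ((Real.exp (-(∑ u, (-ψ) u * ((σ u : ℕ) : ℝ))) : ℝ) : ℂ)))ᴴ) - heisenbergHamiltonian n G J‖ ≤
      |J| * (‖spinRaise n‖ * ‖spinRaise n‖) *
        ∑ u, ∑ v, (if G.Adj u v then Real.cosh (ψ u - ψ v) - 1 else 0) := by
  set W : Op Λ (n + 1) := (Matrix.diagonal fun σ : TensorIndex _ (n + 1) =>
      ((Real.exp (-(∑ u, (ψ) u * ((σ u : ℕ) : ℝ))) : ℝ) : ℂ)) with hW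
  set W' : Op Λ (n + 1) := (Matrix.diagonal fun σ : TensorIndex _ (n + 1) =>
      ((Real.exp (-(∑ u, (-ψ) u * ((σ u : ℕ) : ℝ))) : ℝ) : ℂ)) with hW'
  set s : ℝ := ‖spinRaise n‖ * ‖spinRaise n‖ with hs
  have hs0 : 0 ≤ s := mul_self_nonneg _
  -- the perturbation is additive and real-homogeneous in the operator
  set P : Op Λ (n + 1) → Op Λ (n + 1) := fun B => (2 : ℂ)⁻¹ • (W * B * W' + (W * B * W')ᴴ) - B
    with hP
  have hPsum : ∀ (s' : Finset (Sym2 Λ)) (h : Sym2 Λ → Op Λ (n + 1)),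
      P (∑ e ∈ s', h e) = ∑ e ∈ s', P (h e) := by
    intro s' h
    simp only [hP, Finset.mul_sum, Finset.sum_mul, conjTranspose_sum, ← Finset.sum_add_distrib,
      Finset.smul_sum, ← Finset.sum_sub_distrib]
  have hPsmul : ∀ (r : ℝ) (B : Op Λ (n + 1)), P ((r : ℂ) • B) = (r : ℂ) • P B := by
    intro r B
    have hsr : star (r : ℂ) = r := Complex.conj_ofReal r
    simp only [hP]
    rw [Matrix.mul_smul, Matrix.smul_mul, conjTranspose_smul, hsr, ← smul_add, smul_comm,
      ← smul_sub]
  -- one bond at a time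
  set w : Λ → Λ → ℝ := fun u v => Real.cosh (ψ u - ψ v) - 1 with hw
  have hwsymm : ∀ u v, w u v = w v u := fun u v => by
    simp only [hw]
    rw [← Real.cosh_neg, neg_sub]
  have hw0 : ∀ u v, 0 ≤ w u v := fun u v => by
    simp only [hw]
    linarith [Real.one_le_cosh (ψ u - ψ v)]
  have hbond : ∀ e : Sym2 Λ, ‖P (spinDotSym n e)‖ ≤ s * Sym2.lift ⟨w, hwsymm⟩ e := by
    intro e
    induction e using Sym2.ind with
    | h x y =>
      rw [spinDotSym_mk, Sym2.lift_mk]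
      exact norm_hermitianPart_gauge_spinDot_sub_le ψ x y
  have hmain : ‖P (heisenbergHamiltonian n G J)‖ ≤
      |J| * s * ∑ u, ∑ v, (if G.Adj u v then w u v else 0) := by
    rw [heisenbergHamiltonian, hPsmul, hPsum, norm_smul, Complex.norm_real, Real.norm_eq_abs,
      mul_assoc]
    refine mul_le_mul_of_nonneg_left ?_ (abs_nonneg J)
    calc ‖∑ e ∈ G.edgeFinset, P (spinDotSym n e)‖
        ≤ ∑ e ∈ G.edgeFinset, ‖P (spinDotSym n e)‖ := norm_sum_le _ _
      _ ≤ ∑ e ∈ G.edgeFinset, s * Sym2.lift ⟨w, hwsymm⟩ e := sum_le_sum fun e _ => hbond e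
      _ = s * ∑ e ∈ G.edgeFinset, Sym2.lift ⟨w, hwsymm⟩ e := (Finset.mul_sum _ _ _).symm
      _ ≤ s * ∑ u, ∑ v, (if G.Adj u v then w u v else 0) :=
          mul_le_mul_of_nonneg_left (sum_edgeFinset_lift_le_sum_sum_ite G w hwsymm hw0) hs0
  exact hmain

end Graph

/-! ### The torus Gibbs state of a gauge eigen-operator (Koma–Tasaki eqs. (6), (10)–(12)) -/

section Torus

open Literature.Probability.LatticeModels

variable {d L : ℕ} [NeZero L]

/-- On the torus the graph sum is dominated by the sum over pairs at periodic distance `≤ 1`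
(`torusDist_le_one_of_adj`; the summands are nonnegative). Friedli–Velenik (2017) §3.1 (the torus
and its graph distance). [cite: FriedliVelenik2017, §3.1] -/
theorem sum_adj_cosh_le_sum_torusDist (ψ : TorusSite d L → ℝ) :
    (∑ u : TorusSite d L, ∑ v, (if (torusGraph d L).Adj u v then Real.cosh (ψ u - ψ v) - 1 else 0)) ≤
      ∑ u : TorusSite d L, ∑ v, (if torusDist u v ≤ 1 then Real.cosh (ψ u - ψ v) - 1 else 0) := by
  refine sum_le_sum fun u _ => sum_le_sum fun v _ => ?_
  have h0 : 0 ≤ Real.cosh (ψ u - ψ v) - 1 := by linarith [Real.one_le_cosh (ψ u - ψ v)]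
  by_cases huv : (torusGraph d L).Adj u v
  · rw [if_pos huv, if_pos (torusDist_le_one_of_adj huv)]
  · rw [if_neg huv]
    split_ifs
    · exact h0
    · exact le_rfl

/-- **Koma–Tasaki bound for the torus Gibbs state of the Heisenberg model and a gauge
eigen-operator** (eqs. (6), (10)–(12)): if `W_ψ A W_ψ⁻¹ = a A` then
`|⟨A⟩_{β,L}| ≤ |a| ‖A‖ exp [β |J| ‖Ŝ⁺‖² Σ_u Σ_v [dist ≤ 1] (cosh (ψ_u - ψ_v) - 1)]`, from the
model-independent trace inequality `koma_tasaki_trace_bound` and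
`norm_hermitianPart_gauge_heisenberg_sub_le`. Koma–Tasaki, PRL 68 (1992) 3248, eqs. (6),
(10)–(12) and note [11]. [cite: KomaTasakiPRL1992, eqs. (6), (10)–(12) and note [11]] -/
theorem norm_gibbsState_heisenbergTorus_le (n : ℕ) (J : ℝ) {β : ℝ} (hβ : 0 ≤ β)
    (ψ : TorusSite d L → ℝ) (A : Op (TorusSite d L) (n + 1)) (a : ℂ)
    (hA : ((Matrix.diagonal fun σ : TensorIndex _ (n + 1) =>
      ((Real.exp (-(∑ u, (ψ) u * ((σ u : ℕ) : ℝ))) : ℝ) : ℂ)) : Op (TorusSite d L) (n + 1)) * A *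
      (Matrix.diagonal fun σ : TensorIndex _ (n + 1) =>
      ((Real.exp (-(∑ u, (-ψ) u * ((σ u : ℕ) : ℝ))) : ℝ) : ℂ)) = a • A) :
    ‖gibbsState β (heisenbergTorus d L n J) A‖ ≤
      ‖a‖ * ‖A‖ * Real.exp (β * (|J| * (‖spinRaise n‖ * ‖spinRaise n‖) *
        ∑ u, ∑ v, (if torusDist u v ≤ 1 then Real.cosh (ψ u - ψ v) - 1 else 0))) := by
  set E : ℝ := |J| * (‖spinRaise n‖ * ‖spinRaise n‖) *
    ∑ u : TorusSite d L, ∑ v, (if torusDist u v ≤ 1 then Real.cosh (ψ u - ψ v) - 1 else 0) with hE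
  set W : Op (TorusSite d L) (n + 1) := (Matrix.diagonal fun σ : TensorIndex _ (n + 1) =>
      ((Real.exp (-(∑ u, (ψ) u * ((σ u : ℕ) : ℝ))) : ℝ) : ℂ)) with hW
  set W' : Op (TorusSite d L) (n + 1) := (Matrix.diagonal fun σ : TensorIndex _ (n + 1) =>
      ((Real.exp (-(∑ u, (-ψ) u * ((σ u : ℕ) : ℝ))) : ℝ) : ℂ)) with hW'
  have h1 : W * W' = 1 := gauge_mul_gauge_neg ψ
  have h2 : W' * W = 1 := gauge_neg_mul_gauge ψ
  let Gu : (Op (TorusSite d L) (n + 1))ˣ := ⟨W, W', h1, h2⟩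
  set H : Op (TorusSite d L) (n + 1) := heisenbergTorus d L n J with hH
  have hHh : H.IsHermitian := heisenbergHamiltonian_isHermitian n _ J
  have hβH : ((β : ℂ) • H).IsHermitian := isHermitian_real_smul hHh β
  have key := koma_tasaki_trace_bound hβH Gu A a hA
  have hneg : -((β : ℂ) • H) = -(β : ℂ) • H := (neg_smul _ _).symm
  rw [hneg] at key
  have hdev : ‖(2 : ℂ)⁻¹ • (W * H * W' + (W * H * W')ᴴ) - H‖ ≤ E := by
    have h := norm_hermitianPart_gauge_heisenberg_sub_le (n := n) (torusGraph d L) J ψ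
    refine h.trans ?_
    rw [hE]
    exact mul_le_mul_of_nonneg_left (sum_adj_cosh_le_sum_torusDist ψ)
      (mul_nonneg (abs_nonneg J) (mul_self_nonneg _))
  have hUn : ‖(2 : ℂ)⁻¹ • ((Gu : Op (TorusSite d L) (n + 1)) * ((β : ℂ) • H) *
      ((Gu⁻¹ : (Op (TorusSite d L) (n + 1))ˣ) : Op (TorusSite d L) (n + 1)) +
      ((Gu : Op (TorusSite d L) (n + 1)) * ((β : ℂ) • H) *
      ((Gu⁻¹ : (Op (TorusSite d L) (n + 1))ˣ) : Op (TorusSite d L) (n + 1)))ᴴ) - (β : ℂ) • H‖ ≤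
      β * E := by
    have hGu : (Gu : Op (TorusSite d L) (n + 1)) = W := rfl
    have hGu' : ((Gu⁻¹ : (Op (TorusSite d L) (n + 1))ˣ) : Op (TorusSite d L) (n + 1)) = W' := rfl
    rw [hGu, hGu']
    have hsb : star (β : ℂ) = β := by simp
    have hcalc : (2 : ℂ)⁻¹ • (W * ((β : ℂ) • H) * W' + (W * ((β : ℂ) • H) * W')ᴴ) - (β : ℂ) • H =
        (β : ℂ) • ((2 : ℂ)⁻¹ • (W * H * W' + (W * H * W')ᴴ) - H) := by
      rw [Matrix.mul_smul, Matrix.smul_mul, conjTranspose_smul, hsb, ← smul_add, smul_comm,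
        ← smul_sub]
    rw [hcalc, norm_smul, Complex.norm_real, Real.norm_eq_abs, abs_of_nonneg hβ]
    exact mul_le_mul_of_nonneg_left hdev hβ
  have htr : 0 ≤ ((NormedSpace.exp (-(β : ℂ) • H)).trace).re := by
    rw [← hneg, Complex.re_eq_norm.mpr (posSemidef_exp_of_isHermitian hβH.neg).trace_nonneg]
    exact norm_nonneg _
  refine norm_gibbsState_le_of_trace_bound hHh β A (key.trans ?_)
  gcongr

end Torus

/-! ### Assembly: uniform power-law decay of `⟨𝐒_x · 𝐒_y⟩_{β,L}` (Koma–Tasaki eqs. (12)–(13)) -/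

section Assembly

open Literature.Probability.LatticeModels HigherDimLSM

variable {d : ℕ}

/-- **Uniform power-law decay of the spin–spin correlation of the nearest-neighbour Heisenberg
model** in `d ∈ {1, 2}` at `β > 0`: `|⟨𝐒_x · 𝐒_y⟩_{β,L}| ≤ C' (dist (x, y) + 1)^{-f}` with `f > 0`
and `C'` independent of `L`, `x`, `y`. The four raising/lowering correlations `⟨Ŝ^ε_x Ŝ^{ε'}_y⟩`
are gauge eigen-operators (eigenvalues `e^{εψ_x + ε'ψ_y}`): the mixed ones decay by the
McBryan–Spencer profile (`le_rpow_of_forall_testFunction_range`, range `1`), the equal-sign ones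
vanish (constant profiles); `⟨Ŝˣ Ŝˣ⟩`, `⟨Ŝʸ Ŝʸ⟩` are combinations of the four and
`⟨Ŝᶻ Ŝᶻ⟩ = ⟨Ŝˣ Ŝˣ⟩` by `SU(2)` symmetry (`commute_heisenbergHamiltonian_totalSpin`).
Koma–Tasaki, PRL 68 (1992) 3248, Theorem eq. (4) and note [11]; K. R. Ito, J. Stat. Phys. 29
(1982) 747. [cite: KomaTasakiPRL1992, Theorem eq. (4) and note [11]] -/
theorem exists_abs_spinSpinCorrTorus_le_rpow (hd : 0 < d) (hd2 : d ≤ 2) (n : ℕ) (J : ℝ)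
    {β : ℝ} (hβ : 0 < β) :
    ∃ f : ℝ, 0 < f ∧ ∃ C' : ℝ, ∀ (L : ℕ) [NeZero L] (x y : TorusSite d L),
      |spinSpinCorrTorus β L n J x y| ≤ C' * ((torusDist x y : ℝ) + 1) ^ (-f) := by
  -- the constants
  set ρ : ℕ := 1 with hρ
  set m : ℕ := 1 with hm
  set K : ℝ := |J| * (‖spinRaise n‖ * ‖spinRaise n‖) with hK
  have hK0 : 0 ≤ K := mul_nonneg (abs_nonneg J) (mul_self_nonneg _)
  have hb0 : 0 ≤ β * K := mul_nonneg hβ.le hK0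
  set s₀ : ℝ := ‖spinRaise n‖ with hs₀
  have hA₀ : 0 ≤ s₀ * s₀ := mul_self_nonneg _
  set f : ℝ := 1 / (2 * (2 * (β * K) * (16 * (2 * ρ + 1) ^ d * (m * ρ) ^ 2) + m * ρ + 1)) with hf
  have hf0 : 0 < f := by positivity
  refine ⟨f, hf0, 3 * (s₀ * s₀ * Real.exp 1), fun L _ x y => ?_⟩
  set B : ℝ := s₀ * s₀ * Real.exp 1 * ((torusDist x y : ℝ) + 1) ^ (-f) with hB
  have hB0 : 0 ≤ B := by positivity
  -- the model-dependent gauge bound on this torus, in the shape of the test-function lemma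
  have hgauge : ∀ (ψ : TorusSite d L → ℝ) (A : Op (TorusSite d L) (n + 1)) (a : ℂ),
      ((Matrix.diagonal fun σ : TensorIndex _ (n + 1) =>
      ((Real.exp (-(∑ u, (ψ) u * ((σ u : ℕ) : ℝ))) : ℝ) : ℂ)) : Op (TorusSite d L) (n + 1)) * A *
      (Matrix.diagonal fun σ : TensorIndex _ (n + 1) =>
      ((Real.exp (-(∑ u, (-ψ) u * ((σ u : ℕ) : ℝ))) : ℝ) : ℂ)) = a • A →
      ‖gibbsState β (heisenbergTorus d L n J) A‖ ≤ ‖a‖ * ‖A‖ * Real.exp (β * (K *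
        ∑ u, ∑ v, if torusDist u v ≤ ρ then (Real.cosh (m * (ψ u - ψ v)) - 1) else 0)) := by
    intro ψ A a hA
    have h := norm_gibbsState_heisenbergTorus_le (d := d) (L := L) n J hβ.le ψ A a hA
    have hE : (∑ u : TorusSite d L, ∑ v,
        if torusDist u v ≤ ρ then (Real.cosh (m * (ψ u - ψ v)) - 1) else 0) =
        ∑ u : TorusSite d L, ∑ v, if torusDist u v ≤ 1 then (Real.cosh (ψ u - ψ v) - 1) else 0 := by
      simp [hρ, hm]
    rw [hE]
    exact h
  -- energies of negated and of constant profiles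
  have hEneg : ∀ ψ : TorusSite d L → ℝ,
      (∑ u, ∑ v, if torusDist u v ≤ ρ then (Real.cosh (m * ((-ψ) u - (-ψ) v)) - 1) else 0) =
        ∑ u, ∑ v, if torusDist u v ≤ ρ then (Real.cosh (m * (ψ u - ψ v)) - 1) else 0 := by
    intro ψ
    refine sum_congr rfl fun u _ => sum_congr rfl fun v _ => ?_
    rw [Pi.neg_apply, Pi.neg_apply, show (m : ℝ) * (-ψ u - -ψ v) = -(m * (ψ u - ψ v)) by ring,
      Real.cosh_neg]
  have hEconst : ∀ t : ℝ,
      (∑ u : TorusSite d L, ∑ v : TorusSite d L,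
        if torusDist u v ≤ ρ then (Real.cosh (m * (t - t)) - 1) else 0) = 0 := by
    intro t
    refine sum_eq_zero fun u _ => sum_eq_zero fun v _ => ?_
    rw [sub_self, mul_zero, Real.cosh_zero, sub_self, ite_self]
  -- norms of the observables
  have hnP : ∀ z : TorusSite d L, ‖(onSite z (spinRaise n) : Op (TorusSite d L) (n + 1))‖ = s₀ :=
    fun z => norm_onSite z _
  have hnM : ∀ z : TorusSite d L, ‖(onSite z (spinLower n) : Op (TorusSite d L) (n + 1))‖ = s₀ := by
    intro z
    rw [norm_onSite, spinLower_eq_conjTranspose, l2_opNorm_conjTranspose]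
  have hnorm : ∀ (A A' : Op (TorusSite d L) (n + 1)), ‖A‖ = s₀ → ‖A'‖ = s₀ → ‖A * A'‖ ≤ s₀ * s₀ := by
    intro A A' hA hA'
    calc ‖A * A'‖ ≤ ‖A‖ * ‖A'‖ := l2_opNorm_mul _ _
      _ = s₀ * s₀ := by rw [hA, hA']
  have helper : ∀ {a A c s : ℝ}, A ≤ s → 0 ≤ a → 0 ≤ c → a * A * c ≤ s * a * c := by
    intro a A c s h ha hc
    calc a * A * c = A * (a * c) := by ring
      _ ≤ s * (a * c) := mul_le_mul_of_nonneg_right h (mul_nonneg ha hc)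
      _ = s * a * c := by ring
  -- the four raising/lowering correlations
  have hPM : ‖gibbsState β (heisenbergTorus d L n J)
      (onSite x (spinRaise n) * onSite y (spinLower n))‖ ≤ B := by
    refine le_rpow_of_forall_testFunction_range hd hd2 x y ρ m hb0 hA₀ fun ψ => ?_
    have hev := gauge_conj_mul (-ψ) (gauge_conj_spinRaise (n := n) (-ψ) x)
      (gauge_conj_spinLower (n := n) (-ψ) y)
    refine (hgauge (-ψ) _ _ hev).trans ?_
    rw [hEneg, norm_mul, Complex.norm_real, Complex.norm_real, Real.norm_eq_abs, Real.norm_eq_abs,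
      abs_of_pos (Real.exp_pos _), abs_of_pos (Real.exp_pos _), ← Real.exp_add, Pi.neg_apply,
      Pi.neg_apply, neg_neg, show -ψ x + ψ y = -(ψ x - ψ y) by ring, mul_assoc β K]
    exact helper (hnorm _ _ (hnP x) (hnM y)) (Real.exp_pos _).le (Real.exp_pos _).le
  have hMP : ‖gibbsState β (heisenbergTorus d L n J)
      (onSite x (spinLower n) * onSite y (spinRaise n))‖ ≤ B := by
    refine le_rpow_of_forall_testFunction_range hd hd2 x y ρ m hb0 hA₀ fun ψ => ?_
    have hev := gauge_conj_mul ψ (gauge_conj_spinLower (n := n) ψ x)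
      (gauge_conj_spinRaise (n := n) ψ y)
    refine (hgauge ψ _ _ hev).trans ?_
    rw [norm_mul, Complex.norm_real, Complex.norm_real, Real.norm_eq_abs, Real.norm_eq_abs,
      abs_of_pos (Real.exp_pos _), abs_of_pos (Real.exp_pos _), ← Real.exp_add,
      show -ψ x + ψ y = -(ψ x - ψ y) by ring, mul_assoc β K]
    exact helper (hnorm _ _ (hnM x) (hnP y)) (Real.exp_pos _).le (Real.exp_pos _).le
  have hPP : ‖gibbsState β (heisenbergTorus d L n J)
      (onSite x (spinRaise n) * onSite y (spinRaise n))‖ ≤ B := by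
    refine le_trans ?_ hB0
    refine nonpos_of_forall_le_mul_exp_neg (c := s₀ * s₀) fun t => ?_
    have hev := gauge_conj_mul (fun _ => -(t / 2)) (gauge_conj_spinRaise (n := n) (fun _ => -(t / 2)) x)
      (gauge_conj_spinRaise (n := n) (fun _ : TorusSite d L => -(t / 2)) y)
    refine (hgauge _ _ _ hev).trans ?_
    rw [hEconst, mul_zero, mul_zero, Real.exp_zero, mul_one, norm_mul, Complex.norm_real,
      Real.norm_eq_abs, abs_of_pos (Real.exp_pos _), ← Real.exp_add,
      show -(t / 2) + -(t / 2) = -t by ring]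
    nlinarith [hnorm _ _ (hnP x) (hnP y), Real.exp_pos (-t)]
  have hMM : ‖gibbsState β (heisenbergTorus d L n J)
      (onSite x (spinLower n) * onSite y (spinLower n))‖ ≤ B := by
    refine le_trans ?_ hB0
    refine nonpos_of_forall_le_mul_exp_neg (c := s₀ * s₀) fun t => ?_
    have hev := gauge_conj_mul (fun _ => t / 2) (gauge_conj_spinLower (n := n) (fun _ => t / 2) x)
      (gauge_conj_spinLower (n := n) (fun _ : TorusSite d L => t / 2) y)
    refine (hgauge _ _ _ hev).trans ?_
    rw [hEconst, mul_zero, mul_zero, Real.exp_zero, mul_one, norm_mul, Complex.norm_real,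
      Real.norm_eq_abs, abs_of_pos (Real.exp_pos _), ← Real.exp_add,
      show -(t / 2) + -(t / 2) = -t by ring]
    nlinarith [hnorm _ _ (hnM x) (hnM y), Real.exp_pos (-t)]
  -- the three spin components
  have hsum4 : (1 / 4 : ℝ) *
      (‖gibbsState β (heisenbergTorus d L n J) (onSite x (spinRaise n) * onSite y (spinRaise n))‖ +
        ‖gibbsState β (heisenbergTorus d L n J) (onSite x (spinRaise n) * onSite y (spinLower n))‖ +
        ‖gibbsState β (heisenbergTorus d L n J) (onSite x (spinLower n) * onSite y (spinRaise n))‖ +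
        ‖gibbsState β (heisenbergTorus d L n J) (onSite x (spinLower n) * onSite y (spinLower n))‖)
      ≤ B := by
    linarith
  have h0 : ‖gibbsState β (heisenbergTorus d L n J) (siteSpin n x 0 * siteSpin n y 0)‖ ≤ B :=
    (norm_map_siteSpin_zero_mul_le _ x y).trans hsum4
  have h1 : ‖gibbsState β (heisenbergTorus d L n J) (siteSpin n x 1 * siteSpin n y 1)‖ ≤ B :=
    (norm_map_siteSpin_one_mul_le _ x y).trans hsum4
  have hHS : ∀ α, Commute (heisenbergTorus d L n J) (totalSpin (Λ := TorusSite d L) n α) :=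
    fun α => commute_heisenbergHamiltonian_totalSpin n (torusGraph d L) J α
  have h2 : ‖gibbsState β (heisenbergTorus d L n J) (siteSpin n x 2 * siteSpin n y 2)‖ ≤ B := by
    rw [gibbsState_siteSpin_two_mul_eq hHS]
    exact h0
  -- assemble
  rw [spinSpinCorrTorus_of_neZero]
  refine (Complex.abs_re_le_norm _).trans ((norm_sum_le _ _).trans ?_)
  rw [Fin.sum_univ_three]
  simp only [Matrix.thermalCorr]
  linarith

end Assembly

/-! ### Uniform power-law decay excludes staggered long-range order along even tori -/

section Staggered

open Filter Topology Literature.Probability.LatticeModels HubbardHubbardModelProofs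

variable {d : ℕ}

/-- **Uniform power-law decay excludes Néel (staggered) long-range order on even tori**
(`d ≥ 1`): if `|G_L(x, y)| ≤ C (dist(x, y) + 1)^{-f}` with `f > 0` uniformly in `L ≥ 1`, then
`L^{-2d} Σ_{x,y} (-1)^x (-1)^y G_L(x, y) → 0` along `L = 2k + 2`, hence
`¬ HasStaggeredEvenTorusLRO G` (`|(-1)^x (-1)^y G| = |G|`, row sums
`≤ max(C,0) ((2R+1)^d + L^d (R+1)^{-f})` by `sum_abs_le_of_abs_le_rpow`, `R` and then `L` large;
the staggered form is unfolded by `hasStaggeredEvenTorusLRO_iff_holds`). Friedli–Velenik (2017)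
§3.7.2 / §3.10.3 (long-range order versus decay); Koma–Tasaki, PRL 68 (1992) 3248, remark after the
Theorem. [cite: FriedliVelenik2017, §3.7.2 Definition 3.27 and §3.10.3]
[cite: KomaTasakiPRL1992, remark after the Theorem] -/
theorem not_hasStaggeredEvenTorusLRO_of_abs_le_rpow (hd : d ≠ 0)
    {G : (L : ℕ) → TorusSite d L → TorusSite d L → ℝ} {C f : ℝ} (hf : 0 < f)
    (hG : ∀ (L : ℕ) [NeZero L] (x y : TorusSite d L),
      |G L x y| ≤ C * ((torusDist x y : ℝ) + 1) ^ (-f)) :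
    ¬ HasStaggeredEvenTorusLRO G := by
  classical
  rw [hasStaggeredEvenTorusLRO_iff_holds]
  -- the normalised staggered double sums along `L = 2k + 2`
  set a : ℕ → ℝ := fun k =>
    (∑ x : TorusSite d (2 * k + 2), ∑ y : TorusSite d (2 * k + 2),
        (-1 : ℝ) ^ (∑ i, (x i).val) * (-1) ^ (∑ i, (y i).val) * G (2 * k + 2) x y) /
      ((2 * k + 2 : ℕ) : ℝ) ^ (2 * d) with ha
  set C' : ℝ := max C 0 with hC'
  have hC'0 : 0 ≤ C' := le_max_right _ _
  -- the basic estimate, for every cut-off radius `R` and every side `L ≥ 1`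
  have hest : ∀ (R L : ℕ) [NeZero L],
      |(∑ x : TorusSite d L, ∑ y : TorusSite d L,
          (-1 : ℝ) ^ (∑ i, (x i).val) * (-1) ^ (∑ i, (y i).val) * G L x y) / (L : ℝ) ^ (2 * d)| ≤
        C' * (2 * R + 1 : ℝ) ^ d / (L : ℝ) ^ d + C' * ((R : ℝ) + 1) ^ (-f) := by
    intro R L _
    have hL0 : (0 : ℝ) < (L : ℝ) := by exact_mod_cast Nat.pos_of_ne_zero (NeZero.ne L)
    have hLpos : (0 : ℝ) < (L : ℝ) ^ d := pow_pos hL0 d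
    have hL2pos : (0 : ℝ) < (L : ℝ) ^ (2 * d) := pow_pos hL0 _
    set B : ℝ := (2 * R + 1 : ℝ) ^ d + (L : ℝ) ^ d * ((R : ℝ) + 1) ^ (-f) with hB
    have hsign : ∀ (x y : TorusSite d L),
        |(-1 : ℝ) ^ (∑ i, (x i).val) * (-1) ^ (∑ i, (y i).val) * G L x y| = |G L x y| := by
      intro x y
      rw [abs_mul, abs_mul, abs_pow, abs_pow, abs_neg, abs_one, one_pow, one_pow, one_mul, one_mul]
    have hrow : ∀ x : TorusSite d L,
        |∑ y, (-1 : ℝ) ^ (∑ i, (x i).val) * (-1) ^ (∑ i, (y i).val) * G L x y| ≤ C' * B := by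
      intro x
      calc |∑ y, (-1 : ℝ) ^ (∑ i, (x i).val) * (-1) ^ (∑ i, (y i).val) * G L x y|
          ≤ ∑ y, |(-1 : ℝ) ^ (∑ i, (x i).val) * (-1) ^ (∑ i, (y i).val) * G L x y| :=
            Finset.abs_sum_le_sum_abs _ _
        _ = ∑ y, |G L x y| := sum_congr rfl fun y _ => hsign x y
        _ ≤ C' * B := sum_abs_le_of_abs_le_rpow hf.le (fun x y => hG L x y) x R
    have hS : |∑ x : TorusSite d L, ∑ y,
        (-1 : ℝ) ^ (∑ i, (x i).val) * (-1) ^ (∑ i, (y i).val) * G L x y| ≤ (L : ℝ) ^ d * (C' * B) := by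
      calc |∑ x : TorusSite d L, ∑ y,
            (-1 : ℝ) ^ (∑ i, (x i).val) * (-1) ^ (∑ i, (y i).val) * G L x y|
          ≤ ∑ x : TorusSite d L, |∑ y,
              (-1 : ℝ) ^ (∑ i, (x i).val) * (-1) ^ (∑ i, (y i).val) * G L x y| :=
            Finset.abs_sum_le_sum_abs _ _
        _ ≤ Finset.card (univ : Finset (TorusSite d L)) • (C' * B) :=
            Finset.sum_le_card_nsmul _ _ _ fun x _ => hrow x
        _ = (L : ℝ) ^ d * (C' * B) := by
            rw [nsmul_eq_mul, Finset.card_univ, Fintype.card_pi]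
            simp [ZMod.card, Finset.prod_const]
    rw [abs_div, abs_of_nonneg hL2pos.le, div_le_iff₀ hL2pos]
    calc |∑ x : TorusSite d L, ∑ y,
          (-1 : ℝ) ^ (∑ i, (x i).val) * (-1) ^ (∑ i, (y i).val) * G L x y|
        ≤ (L : ℝ) ^ d * (C' * B) := hS
      _ = (C' * (2 * R + 1 : ℝ) ^ d / (L : ℝ) ^ d + C' * ((R : ℝ) + 1) ^ (-f)) *
            (L : ℝ) ^ (2 * d) := by
          rw [hB, pow_mul, sq]
          field_simp
          ring
  -- hence `a k → 0`
  have hT : Tendsto a atTop (𝓝 0) := by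
    rw [Metric.tendsto_atTop]
    intro ε hε
    have h1 : Tendsto (fun R : ℕ => C' * ((R : ℝ) + 1) ^ (-f)) atTop (𝓝 0) := by
      have := ((tendsto_rpow_neg_atTop hf).comp
        (tendsto_atTop_add_const_right atTop (1 : ℝ) tendsto_natCast_atTop_atTop)).const_mul C'
      simpa using this
    obtain ⟨R, hR⟩ := (h1.eventually (eventually_lt_nhds (half_pos hε))).exists
    have hL : Tendsto (fun k : ℕ => ((2 * k + 2 : ℕ) : ℝ)) atTop atTop :=
      tendsto_natCast_atTop_atTop.comp
        (Filter.tendsto_atTop_mono (fun k : ℕ => (by omega : k ≤ 2 * k + 2)) tendsto_id)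
    have h2 : Tendsto (fun k : ℕ => C' * (2 * R + 1 : ℝ) ^ d / ((2 * k + 2 : ℕ) : ℝ) ^ d)
        atTop (𝓝 0) :=
      tendsto_const_nhds.div_atTop ((tendsto_pow_atTop hd).comp hL)
    obtain ⟨N, hN⟩ := eventually_atTop.1 (h2.eventually (eventually_lt_nhds (half_pos hε)))
    refine ⟨N, fun k hk => ?_⟩
    rw [Real.dist_0_eq_abs]
    calc |a k| ≤ C' * (2 * R + 1 : ℝ) ^ d / ((2 * k + 2 : ℕ) : ℝ) ^ d + C' * ((R : ℝ) + 1) ^ (-f) :=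
          hest R (2 * k + 2)
      _ < ε / 2 + ε / 2 := add_lt_add (hN k hk) hR
      _ = ε := add_halves ε
  intro hLRO
  change 0 < liminf a atTop at hLRO
  rw [hT.liminf_eq] at hLRO
  exact lt_irrefl 0 hLRO

end Staggered

end Literature.MathematicalPhysics.QuantumLattice.MerminWagner

namespace Literature.MathematicalPhysics.QuantumLattice

open MerminWagner Literature.Probability.LatticeModels

/-- **hubbard.S12, nearest-neighbour Heisenberg model** — DISCHARGE of the named fact
`mermin_wagner` of `HeisenbergOrder.lean`: for `d ∈ {1, 2}`, every spin `S = n/2`, every coupling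
`J` and every `β > 0`, the torus Gibbs states of `H_L = J Σ_{⟨x,y⟩} 𝐒_x · 𝐒_y` have no long-range
order of `⟨𝐒_x · 𝐒_y⟩_{β,L}` (`¬ HasTorusLRO`), by the uniform power-law decay
`exists_abs_spinSpinCorrTorus_le_rpow` (Koma–Tasaki / Ito, McBryan–Spencer method for quantum spin
systems) and the summation lemma `not_hasTorusLRO_of_abs_le_rpow`.
Mermin–Wagner, PRL 17 (1966) 1133 (the original statement, magnetisation form); Koma–Tasaki,
PRL 68 (1992) 3248, Theorem eq. (4), note [11] and the remark after the Theorem ("the above bounds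
rigorously rule out ... the corresponding magnetic ordering").
[cite: MerminWagnerPRL1966, main result (pp. 1133–1135)]
[cite: KomaTasakiPRL1992, Theorem eq. (4), note [11] and remark after the Theorem] -/
theorem mermin_wagner_holds : mermin_wagner := by
  intro d hd1 hd n J β hβ
  obtain ⟨f, hf, C', hC'⟩ := exists_abs_spinSpinCorrTorus_le_rpow (d := d) hd1 hd n J hβ
  exact not_hasTorusLRO_of_abs_le_rpow (by omega) hf fun L _ x y => hC' L x y

/-- **hubbard.S12, Néel form** — DISCHARGE of the named fact `mermin_wagner_staggered` of
`HeisenbergOrder.lean`: for `d ∈ {1, 2}`, every spin `S = n/2`, every `J` and every `β > 0`, the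
torus Gibbs states of the nearest-neighbour Heisenberg model have no staggered (Néel) long-range
order along the even tori (`¬ HasStaggeredEvenTorusLRO`) — the antiferromagnetic half of
Mermin–Wagner's title — by the same uniform power-law decay (`|(-1)^{x+y} G| = |G|`) and
`not_hasStaggeredEvenTorusLRO_of_abs_le_rpow`.
Mermin–Wagner, PRL 17 (1966) 1133 (antiferromagnetic case); Koma–Tasaki, PRL 68 (1992) 3248,
Theorem eq. (4), note [11] and the remark after the Theorem.
[cite: MerminWagnerPRL1966, main result (pp. 1133–1135, antiferromagnetic case)]
[cite: KomaTasakiPRL1992, Theorem eq. (4), note [11] and remark after the Theorem] -/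
theorem mermin_wagner_staggered_holds : mermin_wagner_staggered := by
  intro d hd1 hd n J β hβ
  obtain ⟨f, hf, C', hC'⟩ := exists_abs_spinSpinCorrTorus_le_rpow (d := d) hd1 hd n J hβ
  exact not_hasStaggeredEvenTorusLRO_of_abs_le_rpow (by omega) hf fun L _ x y => hC' L x y

end Literature.MathematicalPhysics.QuantumLattice
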